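import Mathlib
import HarnessLib.Audit
import Summits.PneNP.PneNP.Theorems.PstarGateU2Corner
import Summits.PneNP.PneNP.Theorems.PstarBridgeUnread
import Summits.PneNP.PneNP.Theorems.PstarNorUnitEQ1Tools
import Summits.PneNP.PneNP.Theorems.PstarChordBridgeNor

/-!
# One GATED chord, node N5: the constraints read only the variables of the companion chord's fundamental set — JOINS confined, no foreign bridges (E2; prover-1 g19)

FRONTIER range-avoidance ladder, rung F-N3 (`stmt-PneNP-19007`), cell `pnp-ideate` (`PstarGateNodesX.GateU2X`); restricted-model proof complexity —
nothing here bears on `P` versus `NP`.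

A refinement of `PstarChordBridgeCornerUnit.dir_cases_of_factor`: whatever the outcome (constant factor, (EQ), EXC-unit, NOR-unit), the polar form of
the directional constraint `q_m` VANISHES against every basis vector `e_c` with `c` outside the AND variables `V'` of the fundamental set `D e`
(`polarDir_off_fundamental`: (EQ) has the polar form of `Q_{D e}`; the EXC-unit adds `sym(ℓ_{μ₁} ⊗ ℓ_{μ₂})` whose literal functionals live on
`{σ, τ} ⊆ V'` (`PstarNorUnitExc.exc_unit_of_dir`); the NOR-unit's polar form is `sym(λ_b ⊗ λ_a)` with the same support (`PstarNorUnitDir.nor_unit_of_dir`)).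
For one-gate data with a doubly-read companion chord `e'` (directions `r, r'` spanning `𝔽₂²`, companion polar forms = original ones):

* `u2_joins` — **every tree edge outside `D e'` with an AND variable outside `V' = ⋃_{j ∈ D e'} andPair j` lies in neither join `T₁, T₂`**
  (`polarDir_single_pair`);
* `u2_no_bridge` — **hence no such tree edge is a bridge** (off `D e ∪ D e'`): `PstarBridgeUnread.false_of_bridge_minimal` with (M0).
-/

set_option linter.dupNamespace false -- `Summit.PneNP.PneNP.…`: summit = sub-problem name (D-0017 single-conjunct layout)

open Finset Module Literature.Computability.Complexity
open Summit.PneNP.PneNP.Theorems.PstarTyped (Typed)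
open Summit.PneNP.PneNP.Theorems.PstarSALevel (BoundaryExpanding SimpleOverlap)
open Summit.PneNP.PneNP.Theorems.PstarGapLinearised (andPair)
open Summit.PneNP.PneNP.Theorems.PstarChordEndgameTools (mem_andPair_iff)
open Summit.PneNP.PneNP.Theorems.PstarXCore (xverts)
open Summit.PneNP.PneNP.Theorems.PstarCoreBound (XorClosed)
open Summit.PneNP.PneNP.Theorems.PstarCubeIdeals (IsAffineFn)
open Summit.PneNP.PneNP.Theorems.PstarRankRigidityTwo (linPart symForm symForm_apply linPart_apply affine_mul_polar)
open Summit.PneNP.PneNP.Theorems.PstarForcing (forcing_cases polar_unique)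
open Summit.PneNP.PneNP.Theorems.PstarProductRank (qform polar polar_apply)
open Summit.PneNP.PneNP.Theorems.PstarReadSumset (V2)
open Summit.PneNP.PneNP.Theorems.PstarChordSystem (ChordSystem)
open Summit.PneNP.PneNP.Theorems.PstarChordBridgeTools (privs coef)
open Summit.PneNP.PneNP.Theorems.PstarChordBridge (BridgeData sys Solution Lift infeasible_of_not_solution)
open Summit.PneNP.PneNP.Theorems.PstarChordBridgeForcing (gam freeMon sys_u_eq qform_add' rank_four_of_wf)
open Summit.PneNP.PneNP.Theorems.PstarChordBridgeBasis (qDir polarDir)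
open Summit.PneNP.PneNP.Theorems.PstarChordBridgeCorner (qDir_add decomp_V2)
open Summit.PneNP.PneNP.Theorems.PstarNorUnitDir (nor_unit_of_dir)
open Summit.PneNP.PneNP.Theorems.PstarNorUnitExc (exc_unit_of_dir)
open Summit.PneNP.PneNP.Theorems.PstarNorUnitEQ1Tools (polarDir_single_pair)
open Summit.PneNP.PneNP.Theorems.PstarChordBridgeNor (polarDir_comm)
open Summit.PneNP.PneNP.Theorems.PstarGateBridge (GateHyp const_of_others)
open Summit.PneNP.PneNP.Theorems.PstarGateCompanion
open Summit.PneNP.PneNP.Theorems.PstarGateNodes (GateData)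
open Summit.PneNP.PneNP.Theorems.PstarGateNodesX (GateDataX)
open Summit.PneNP.PneNP.Theorems.PstarGateU2Corner (qDir_companion_dir u2_factor)
open Summit.PneNP.PneNP.Theorems.PstarBridgeUnread (false_of_bridge_minimal)

namespace Summit.PneNP.PneNP.Theorems.PstarGateU2Joins

variable {n m : ℕ}

/-- The polar form of `Q_D` vanishes against `e_c` for `c` outside the AND variables of `D`. -/
theorem polar_single_off (I : LocalMap 4 n m) (D : Finset (Fin m)) {c : Fin n} (hc : c ∉ D.biUnion (andPair I)) (y : Fin n → ZMod 2) :
    polar D (fun j => I.vars j 2) (fun j => I.vars j 3) (Pi.single c 1) y = 0 := by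
  classical
  rw [polar_apply]
  refine sum_eq_zero fun j hj => ?_
  have h2 : I.vars j 2 ≠ c := fun h => hc (mem_biUnion.2 ⟨j, hj, (mem_andPair_iff I j c).2 (Or.inl h.symm)⟩)
  have h3 : I.vars j 3 ≠ c := fun h => hc (mem_biUnion.2 ⟨j, hj, (mem_andPair_iff I j c).2 (Or.inr h.symm)⟩)
  rw [Pi.single_eq_of_ne h2, Pi.single_eq_of_ne h3, zero_mul, zero_mul, add_zero]

/-- **The directional constraint of a factorisation reads only the AND variables of the fundamental set.**  Bridge data as in
`dir_cases_of_factor` (pure `(r,3/2)`-expanding, simple overlaps, `#(J₀ ∪ G₁ ∪ G₂) ≤ r`, `e ∈ N ∖ (G₁ ∪ G₂)`), a direction `m` and a factorisation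
`γ_e + Q_{D e} = f · q_m + 1`: the polar form of `q_m` vanishes against `e_c` for every `c` outside `⋃_{j ∈ D e} andPair j`. -/
theorem polarDir_off_fundamental (I : LocalMap 4 n m) (hI : I.IsPure xorAndPred) (hS : SimpleOverlap I) {r : ℕ} (hB : BoundaryExpanding r I)
    {B : BridgeData n m} (hW : B.WF I) (hr : (B.J₀ ∪ B.G₁ ∪ B.G₂).card ≤ r) {e : Fin m} (he : e ∈ B.N) (heG : e ∉ B.G₁ ∪ B.G₂) (mv : V2)
    {f : (Fin n → ZMod 2) → ZMod 2}
    (hF : ∀ x, gam B e + qform (B.D e) (fun j => I.vars j 2) (fun j => I.vars j 3) x = f x * qDir I B mv x + 1) :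
    ∀ c : Fin n, c ∉ (B.D e).biUnion (andPair I) → ∀ y, polarDir I B mv (Pi.single c 1) y = 0 := by
  classical
  intro c hc y
  have hqB := qDir_add I B mv
  have hQB := qform_add' I (B.D e)
  by_cases hnc : ∃ κ, ∀ x, qDir I B mv x = κ
  · -- a constant form has polar zero
    obtain ⟨κ, hκ⟩ := hnc
    have h := hqB (Pi.single c 1) y
    rw [hκ, hκ, hκ, hκ] at h
    have e4 : ∀ k s : ZMod 2, k = k + k + k + s → s = 0 := by decide
    exact e4 _ _ h
  have hJr : B.J₀.card ≤ r := (card_le_card (subset_union_left.trans subset_union_left)).trans hr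
  have hrank := rank_four_of_wf I hI hS hB hW hJr he
  have hZ : ∀ x, qDir I B mv x = 0 → qform (B.D e) (fun j => I.vars j 2) (fun j => I.vars j 3) x = gam B e + 1 := by
    intro x hx
    have h := hF x
    rw [hx, mul_zero, zero_add] at h
    have e1 : ∀ g Q : ZMod 2, g + Q = 1 → Q = g + 1 := by decide
    exact e1 _ _ h
  -- (EQ): the polar forms agree
  have hEQ : ∀ κ : ZMod 2, (∀ x, qform (B.D e) (fun j => I.vars j 2) (fun j => I.vars j 3) x = qDir I B mv x + κ) →
      polarDir I B mv (Pi.single c 1) y = 0 := by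
    intro κ hκ
    have hq' : ∀ x w, qDir I B mv (x + w) = qDir I B mv x + qDir I B mv w + qDir I B mv 0 +
        polar (B.D e) (fun j => I.vars j 2) (fun j => I.vars j 3) x w := by
      intro x w
      have h := hQB x w
      rw [hκ (x + w), hκ x, hκ w, hκ 0] at h
      have e4 : ∀ a b d z s k : ZMod 2, a + k = b + k + (d + k) + (z + k) + s → a = b + d + z + s := by decide
      exact e4 _ _ _ _ _ _ h
    rw [polar_unique hqB hq', polar_single_off I (B.D e) hc y]
  rcases forcing_cases hqB hQB hrank hZ with h1 | ⟨κ, hκ⟩ | ⟨μ₁, μ₂, hμ₁, hμ₂, κ, hκ⟩ | ⟨a, b, hab, hqf, m₁, m₂, hm₁, hm₂, hQ⟩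
  · exact absurd ⟨1, h1⟩ hnc
  · exact hEQ κ hκ
  · rcases exc_unit_of_dir I hI hS hB hW hr he heG mv hZ hμ₁ hμ₂ hκ with ⟨κ', hκ'⟩ | ⟨j₁, j₂, σ, τ, hne, hD, hdisj, hσ, hτ, hlit, -⟩
    · exact hEQ κ' hκ'
    · -- EXC-unit: `polar q = polar Q + sym(ℓ_{μ₁} ⊗ ℓ_{μ₂})`, and the literal functionals vanish at `e_c`
      set Sf : LinearMap.BilinForm (ZMod 2) (Fin n → ZMod 2) :=
        polar (B.D e) (fun j => I.vars j 2) (fun j => I.vars j 3) + symForm (linPart hμ₁) (linPart hμ₂) with hSf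
      have hq' : ∀ x w, qDir I B mv (x + w) = qDir I B mv x + qDir I B mv w + qDir I B mv 0 + Sf x w := by
        intro x w
        rw [hSf, LinearMap.add_apply, LinearMap.add_apply]
        have h := hQB x w
        rw [hκ (x + w), hκ x, hκ w, hκ 0, affine_mul_polar hμ₁ hμ₂] at h
        generalize qDir I B mv (x + w) = q1 at h ⊢; generalize qDir I B mv x = q2 at h ⊢; generalize qDir I B mv w = q3 at h ⊢
        generalize qDir I B mv 0 = q0 at h ⊢
        generalize μ₁ x * μ₂ x = p2 at h; generalize μ₁ w * μ₂ w = p3 at h; generalize μ₁ 0 * μ₂ 0 = p0 at h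
        generalize polar (B.D e) (fun j => I.vars j 2) (fun j => I.vars j 3) x w = s at h ⊢
        generalize symForm (linPart hμ₁) (linPart hμ₂) x w = t at h ⊢
        revert h
        generalize κ = k
        revert q1 q2 q3 q0 p2 p3 p0 s t k; decide
      rw [polar_unique hqB hq', hSf, LinearMap.add_apply, LinearMap.add_apply, polar_single_off I (B.D e) hc y, zero_add, symForm_apply]
      have hcσ : c ≠ σ := fun h => hc (mem_biUnion.2 ⟨j₁, by rw [hD]; exact mem_insert_self _ _, h ▸ hσ⟩)
      have hcτ : c ≠ τ := fun h => hc (mem_biUnion.2 ⟨j₂, by rw [hD]; exact mem_insert_of_mem (mem_singleton_self _), h ▸ hτ⟩)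
      have hno : ¬ (μ₁ (Pi.single c 1) ≠ μ₁ 0 ∨ μ₂ (Pi.single c 1) ≠ μ₂ 0) := fun h => by
        rcases (hlit c).1 h with h' | h'
        · exact hcσ h'
        · exact hcτ h'
      push Not at hno
      simp only [linPart_apply, hno.1, hno.2, CharTwo.add_self_eq_zero, zero_mul, mul_zero]
  · obtain ⟨j₁, j₂, σ, τ, hne, hD, hdisj, hσ, hτ, hlit, -⟩ :=
      nor_unit_of_dir I hI hS hB hW hr he heG mv (β := qDir I B mv b + qDir I B mv 0) (α := qDir I B mv a + qDir I B mv 0) hqf hm₁ hm₂ hQ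
    -- NOR-unit: `polar q = sym(λ_b ⊗ λ_a)`, and both literal functionals vanish at `e_c`
    set fP := polarDir I B mv with hfP
    set β' : ZMod 2 := qDir I B mv b + qDir I B mv 0 with hβ'
    set α' : ZMod 2 := qDir I B mv a + qDir I B mv 0 with hα'
    have haff : ∀ (z : Fin n → ZMod 2) (k : ZMod 2), IsAffineFn (fun x => fP x z + k) := by
      intro z k x w
      show fP (x + w) z + k = fP x z + k + (fP w z + k) + (fP 0 z + k)
      rw [map_add, LinearMap.add_apply, map_zero, LinearMap.zero_apply, zero_add]
      generalize fP x z = s; generalize fP w z = t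
      revert s t k; decide
    have hlin : ∀ (z : Fin n → ZMod 2) (k : ZMod 2) (x : Fin n → ZMod 2), linPart (haff z k) x = fP x z := by
      intro z k x
      rw [linPart_apply]
      show fP x z + k + (fP 0 z + k) = fP x z
      rw [map_zero, LinearMap.zero_apply, zero_add]
      generalize fP x z = s
      revert s k; decide
    have hq' : ∀ x w, qDir I B mv (x + w) = qDir I B mv x + qDir I B mv w + qDir I B mv 0 + symForm (linPart (haff b β')) (linPart (haff a α')) x w := by
      intro x w
      rw [hqf (x + w), hqf x, hqf w, hqf 0, affine_mul_polar (haff b β') (haff a α')]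
      generalize (fP x b + β') * (fP x a + α') = p1
      generalize (fP w b + β') * (fP w a + α') = p2
      generalize (fP 0 b + β') * (fP 0 a + α') = p0
      generalize symForm (linPart (haff b β')) (linPart (haff a α')) x w = s
      revert p1 p2 p0 s; decide
    have hcσ : c ≠ σ := fun h => hc (mem_biUnion.2 ⟨j₁, by rw [hD]; exact mem_insert_self _ _, h ▸ hσ⟩)
    have hcτ : c ≠ τ := fun h => hc (mem_biUnion.2 ⟨j₂, by rw [hD]; exact mem_insert_of_mem (mem_singleton_self _), h ▸ hτ⟩)
    have hno : ¬ (fP (Pi.single c 1) b ≠ 0 ∨ fP (Pi.single c 1) a ≠ 0) := fun h => by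
      rcases (hlit c).1 h with h' | h'
      · exact hcσ h'
      · exact hcτ h'
    push Not at hno
    have hpol := polar_unique hqB hq'
    show fP (Pi.single c 1) y = 0
    rw [hpol, symForm_apply, hlin, hlin, hlin, hlin, hno.1, hno.2, zero_mul, mul_zero, add_zero]

/-- The companion's directional polar form is the original one (the two constraints differ by the affine `m₂·ℓ`). -/
theorem polarDir_companion_dir (I : LocalMap 4 n m) (hI : I.IsPure xorAndPred) {B : BridgeData n m} (hW : B.WF I) {e : Fin m} (hG : GateHyp I B e)
    {g₀ : Fin m} (hg₀ : g₀ ∈ B.G₁) {u : Fin n} (hgv : (I.vars g₀ 2 = I.vars e 2 ∧ I.vars g₀ 3 = u) ∨ (I.vars g₀ 2 = u ∧ I.vars g₀ 3 = I.vars e 2))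
    (hu : u ∉ privs I B.N) (hux : u ∉ xverts I (B.J₀ \ B.N)) (hG₁p : ∀ g ∈ B.G₁.erase g₀, I.vars g 2 ≠ I.vars e 2 ∧ I.vars g 3 ≠ I.vars e 2)
    (hcoef : ∃ κ₀ : ZMod 2, ∀ x, coef I B.C₁ B.G₁ (I.vars e 2) x = κ₀ + x u) (mv : V2) :
    polarDir I (companion I B e g₀ u (decide (I.vars e 2 ∈ B.C₁))) mv = polarDir I B mv := by
  obtain ⟨κ₀, hκ₀⟩ := hcoef
  set B₀ := companion I B e g₀ u (decide (I.vars e 2 ∈ B.C₁)) with hB₀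
  have hq₀ := qDir_add I B₀ mv
  have hq : ∀ x w, qDir I B₀ mv (x + w) = qDir I B₀ mv x + qDir I B₀ mv w + qDir I B₀ mv 0 + polarDir I B mv x w := by
    intro x w
    rw [qDir_companion_dir I hI hW hG hg₀ hgv hu hux hG₁p mv, qDir_companion_dir I hI hW hG hg₀ hgv hu hux hG₁p mv,
      qDir_companion_dir I hI hW hG hg₀ hgv hu hux hG₁p mv, qDir_companion_dir I hI hW hG hg₀ hgv hu hux hG₁p mv, qDir_add I B mv, hκ₀, hκ₀, hκ₀, hκ₀,
      Pi.add_apply, Pi.zero_apply]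
    generalize qDir I B mv x = q1; generalize qDir I B mv w = q2; generalize qDir I B mv 0 = q0; generalize polarDir I B mv x w = s
    generalize x u = a; generalize w u = b; generalize mv.2 = c; generalize κ₀ = k
    revert q1 q2 q0 s a b c k; decide
  exact polar_unique hq₀ hq

/-- `polarDir` is linear in the direction (pointwise form). -/
theorem polarDir_lin (I : LocalMap 4 n m) (B : BridgeData n m) (a b : ZMod 2) (v w : V2) (x y : Fin n → ZMod 2) :
    polarDir I B (a • v + b • w) x y = a * polarDir I B v x y + b * polarDir I B w x y := by
  unfold PstarChordBridgeBasis.polarDir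
  simp only [LinearMap.add_apply, LinearMap.smul_apply, smul_eq_mul, Prod.smul_fst, Prod.smul_snd, Prod.fst_add, Prod.snd_add]
  ring

/-- **Joins confined**: a tree edge outside `D e'` with an AND variable outside `⋃_{j ∈ D e'} andPair j` lies in neither join. -/
theorem u2_joins (I : LocalMap 4 n m) (hI : I.IsPure xorAndPred) (hT : Typed I) (hS : SimpleOverlap I) {r₀ : ℕ}
    (hB : BoundaryExpanding r₀ I) {B : BridgeData n m} {e g₀ : Fin m} {u : Fin n} {κ₀ : ZMod 2} (hD : GateDataX I r₀ B e g₀ u κ₀)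
    {e' : Fin m} (hN : B.N = {e, e'}) (hne : e' ≠ e)
    (hU2 : ∀ a, (sys I B).ρ e' a ≠ 0 ∧ (sys I B).ρ' e' a ≠ 0 ∧ (sys I B).ρ e' a ≠ (sys I B).ρ' e' a)
    {j : Fin m} (hj : j ∈ B.J₀ \ B.N) (hc : I.vars j 2 ∉ (B.D e').biUnion (andPair I) ∨ I.vars j 3 ∉ (B.D e').biUnion (andPair I)) :
    j ∉ B.T₁ ∧ j ∉ B.T₂ := by
  classical
  obtain ⟨-, hW, hr, hd₁, hd₂, hL, -, -, hG, hg₀, hgv, -, hup, hux, hG₁p, hcoef, hT3, -⟩ := id hD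
  set B₀ := companion I B e g₀ u (decide (I.vars e 2 ∈ B.C₁)) with hB₀
  have he' : e' ∈ B.N := by rw [hN]; exact mem_insert_of_mem (mem_singleton_self _)
  have he'J : e' ∈ B.J₀ := hW.hN he'
  have he'₀ : e' ∈ B₀.N := by rw [hB₀, companion_N]; exact mem_erase.2 ⟨hne, he'⟩
  have hW₀ : B₀.WF I := companion_wf I hI hT hW hG g₀ hux _
  have hr₀ : (B₀.J₀ ∪ B₀.G₁ ∪ B₀.G₂).card ≤ r₀ := by
    refine le_trans (card_le_card ?_) hr
    rw [hB₀, companion_J₀, companion_G₁, companion_G₂]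
    exact union_subset_union (union_subset_union (subset_refl _) (erase_subset _ _)) (subset_refl _)
  have heG₀ : e' ∉ B₀.G₁ ∪ B₀.G₂ := by
    rw [hB₀, companion_G₁, companion_G₂]
    intro h
    rcases mem_union.1 h with h | h
    · exact disjoint_left.1 hd₁ (mem_of_mem_erase h) he'J
    · exact disjoint_left.1 hd₂ h he'J
  have hfac := u2_factor I hI hT hD hN hne hU2
  have hgam : gam B₀ e' = gam B e' := rfl
  have hDe : B₀.D e' = B.D e' := rfl
  -- polar vanishing for both read directions (on the companion, hence on `B`)
  have hpol := polarDir_companion_dir I hI hW hG hg₀ hgv hup hux hG₁p ⟨κ₀, hcoef⟩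
  have hvan : ∀ mv : V2, (mv = (sys I B).ρ e' 0 ∨ mv = (sys I B).ρ' e' 0) →
      ∀ c : Fin n, c ∉ (B.D e').biUnion (andPair I) → ∀ y, polarDir I B mv (Pi.single c 1) y = 0 := by
    intro mv hmv c hc y
    rw [← hpol mv]
    rcases hmv with rfl | rfl
    · refine polarDir_off_fundamental I hI hS hB hW₀ hr₀ he'₀ heG₀ _ (f := fun x => qDir I B₀ ((sys I B).ρ' e' 0) x) (fun x => ?_) c hc y
      rw [hgam, hDe, ← sys_u_eq]; exact hfac x
    · refine polarDir_off_fundamental I hI hS hB hW₀ hr₀ he'₀ heG₀ _ (f := fun x => qDir I B₀ ((sys I B).ρ e' 0) x) (fun x => ?_) c hc y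
      rw [hgam, hDe, ← sys_u_eq, mul_comm]; exact hfac x
  -- spanning: `(1,0)` and `(0,1)` are combinations of `r, r'`, and `polarDir` is linear in the direction
  have hboth : ∀ c : Fin n, c ∉ (B.D e').biUnion (andPair I) → ∀ y,
      polarDir I B (1, 0) (Pi.single c 1) y = 0 ∧ polarDir I B (0, 1) (Pi.single c 1) y = 0 := by
    intro c hc y
    have h1 := hvan _ (Or.inl rfl) c hc y
    have h2 := hvan _ (Or.inr rfl) c hc y
    obtain ⟨hr1, hr2, hr12⟩ := hU2 0
    constructor
    · rw [decomp_V2 hr1 hr2 hr12 (1, 0), polarDir_lin, h1, h2, mul_zero, mul_zero, add_zero]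
    · rw [decomp_V2 hr1 hr2 hr12 (0, 1), polarDir_lin, h1, h2, mul_zero, mul_zero, add_zero]
  obtain ⟨hjJ, hjN⟩ := mem_sdiff.1 hj
  have hpair1 := polarDir_single_pair I hI hS hd₁ hd₂ (0, 1) hjJ
  have hpair2 := polarDir_single_pair I hI hS hd₁ hd₂ (1, 0) hjJ
  simp only [add_zero, one_mul, zero_mul, zero_add] at hpair1 hpair2
  -- evaluate at the AND pair of `j`
  have hzero : polarDir I B (1, 0) (Pi.single (I.vars j 2) 1) (Pi.single (I.vars j 3) 1) = 0 ∧
      polarDir I B (0, 1) (Pi.single (I.vars j 2) 1) (Pi.single (I.vars j 3) 1) = 0 := by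
    rcases hc with hc | hc
    · exact hboth _ hc _
    · obtain ⟨h1, h2⟩ := hboth _ hc (Pi.single (I.vars j 2) 1)
      exact ⟨by rw [polarDir_comm]; exact h1, by rw [polarDir_comm]; exact h2⟩
  constructor
  · intro hjT
    have h := hzero.2
    rw [hpair1, if_pos hjT] at h
    exact one_ne_zero h
  · intro hjT
    have h := hzero.1
    rw [hpair2, if_pos hjT] at h
    exact one_ne_zero h

/-- **No foreign bridges**: a tree edge off both fundamental sets with an AND variable outside `⋃_{j ∈ D e'} andPair j` cannot exist. -/
theorem u2_no_bridge (I : LocalMap 4 n m) (hI : I.IsPure xorAndPred) (hT : Typed I) (hS : SimpleOverlap I) {r₀ : ℕ}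
    (hB : BoundaryExpanding r₀ I) {B : BridgeData n m} {e g₀ : Fin m} {u : Fin n} {κ₀ : ZMod 2} (hD : GateDataX I r₀ B e g₀ u κ₀)
    {e' : Fin m} (hN : B.N = {e, e'}) (hne : e' ≠ e)
    (hU2 : ∀ a, (sys I B).ρ e' a ≠ 0 ∧ (sys I B).ρ' e' a ≠ 0 ∧ (sys I B).ρ e' a ≠ (sys I B).ρ' e' a)
    {b : Fin m} (hb : b ∈ B.J₀ \ B.N) (hbe : b ∉ B.D e) (hbe' : b ∉ B.D e')
    (hc : I.vars b 2 ∉ (B.D e').biUnion (andPair I) ∨ I.vars b 3 ∉ (B.D e').biUnion (andPair I)) : False := by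
  obtain ⟨hX, hW, -, -, -, hL, -, -, -, -, -, -, -, -, -, -, hT3, hM0⟩ := id hD
  obtain ⟨hT₁, hT₂⟩ := u2_joins I hI hT hS hB hD hN hne hU2 hb hc
  have hinf : (sys I B).Infeasible B.N := infeasible_of_not_solution I hI hT hW hL hT3
  have hbD : ∀ c ∈ B.N, b ∉ B.D c := by
    intro c hc'
    rw [hN, mem_insert, mem_singleton] at hc'
    rcases hc' with rfl | rfl
    · exact hbe
    · exact hbe'
  obtain ⟨z, hz⟩ := hM0 b (mem_sdiff.1 hb).1
  exact false_of_bridge_minimal I hI hT hW hX hinf hb hbD hT₁ hT₂ hz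

end Summit.PneNP.PneNP.Theorems.PstarGateU2Joins
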